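import Literature.NumberTheory.Weil1964.AdicCompletionWeilIndexHilbertSymbol
import Literature.NumberTheory.Weil1964.LocalWeilIndexQuadraticForm
import Literature.NumberTheory.QuadraticForms.HilbertSymbolBilinear
import Literature.NumberTheory.QuadraticForms.HasseInvariantFrames
import HarnessLib

/-!
# The Weil index of a quadratic form at a finite place: `γ(f) = γ(x²)ⁿ⁻¹ · γ(disc f) · ε(f)` (Rao's appendix)

Topic `NumberTheory/Weil1964`; namespace `Literature.NumberTheory.Weil1964`. KERNEL mathematics only (theorems; no
definition, no named fact, no `axiom`, no `sorry`). Sequel of `AdicCompletionWeilIndexHilbertSymbol.lean` (Weil's law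
(28) at every finite place `K_v` of a number field, hypothesis-free) and `LocalWeilIndexQuadraticForm.lean` (`γ(f) = Π γ(cᵢxᵢ²)`
for any diagonalisation of a non-degenerate form `f` on `Fⁿ`).

For `F = K_v`, a non-trivial continuous `ψ`, a Haar measure `μ`, and `γ(a) = γ_ψ(a x²)` (`weilIndex ψ μ a`):

* §1 **Rao's Theorem A.4 (Weil p. 176) in symmetric form**: `γ(a) γ(b) = (a, b)_v · γ(1) γ(ab)` for `a b ≠ 0` — i.e. Rao's
  normalised index `γ_F(a, ψ) = γ(a)/γ(1)` satisfies `γ_F(ab) γ_F(a)⁻¹ γ_F(b)⁻¹ = (a, b)_F`; derived from Weil's (28)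
  `γ(b)γ(-ab) = (a,b)γ(1)γ(-a)` and the bimultiplicativity of `( , )_v`;
* §0 (any `F`) `γ_{rψ}(a) = γ_ψ(ra)`; Rao's Cor. A.5(1) `γ_F(a, cψ) = (a,c)_F γ_F(a, ψ)` at `K_v`;
* §2 `(a, Π bⱼ)_v = Π (a, bⱼ)_v`;
* §3 **Rao's Lemma A.7 (3)**: for a diagonal form `Σ cᵢ xᵢ²` (`cᵢ ≠ 0`, `c : Fin n → K_v`),
  `(Πᵢ γ(cᵢ)) · γ(1) = γ(1)ⁿ · γ(Π cᵢ) · Π_{i<j} (cᵢ, cⱼ)_v` — with the tree's Hasse product `hasseProd` (Serre's `ε`);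
* §4 hence for every non-degenerate quadratic form `f` on `K_vⁿ` and ANY diagonalisation `f = (Σ cᵢ xᵢ²) ∘ A`:
  **`γ(f) · γ(1) = γ(1)ⁿ · γ(disc) · ε`**, `disc = Π cᵢ`, `ε = Π_{i<j} (cᵢ, cⱼ)_v` — Rao's Definition A.6 of the Hasse invariant
  `h_F(Q) = γ(ψ∘Q) γ_F(ψ)⁻ⁿ γ_F(det Q, ψ)⁻¹` computed as `Π_{i<j}(cᵢ,cⱼ)`. This is the formula through which the Weil index
  enters Rao's cocycle and Kudla's splitting (`γ_F(η ∘ R_V)`).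

## References

* [Rangarao1993] R. Ranga Rao, *On some explicit formulas in the theory of Weil representation*, Pacific J. Math. 157
  (1993) 335–371, Appendix: Thm A.4 (p. 367), Def. A.6, Lemma A.7 (pp. 367–368).
* [Weil1964] A. Weil, *Sur certains groupes d'opérateurs unitaires*, Acta Math. 111 (1964), Chap. II n° 28 p. 176.
* [Serre1973] J.-P. Serre, *A Course in Arithmetic*, Ch. IV §2.1 (`ε = Π_{i<j}(aᵢ,aⱼ)`; tree `hasseProd`).
-/

set_option autoImplicit false

noncomputable section

open MeasureTheory Set NumberField IsDedekindDomain QuadraticMap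

namespace Literature.NumberTheory.Weil1964

/-! ## §0 Dilating the character: `γ_{ψ_r}(a) = γ_ψ(r a)` (any non-archimedean local field) -/

section Dilation

variable {F : Type*} [Field F] [ValuativeRel F] [TopologicalSpace F] [IsNonarchimedeanLocalField F]
  [MeasurableSpace F] (μ : Measure F) (ψ : AddChar F Circle)

omit [ValuativeRel F] [TopologicalSpace F] [IsNonarchimedeanLocalField F] [MeasurableSpace F] in
/-- `(r η) ∘ (a x²) = η ∘ ((r a) x²)`: dilating the character multiplies the coefficient (Rao's `aη : x ↦ η(ax)`).
[cite: Rangarao1993, Appendix A.3, p. 367] -/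
theorem psiSq_mulShift (r a : F) : psiSq (ψ.mulShift r) a = psiSq ψ (r * a) := by
  funext x
  rw [psiSq_apply, psiSq_apply, AddChar.mulShift_apply, mul_assoc]

/-- `g_{rη}(a x², 𝔭ⁿ) = g_η((r a) x², 𝔭ⁿ)`. [cite: Rangarao1993, Appendix A.3, p. 367] -/
theorem gaussBall_mulShift (r a : F) (n : ℤ) : gaussBall (ψ.mulShift r) μ a n = gaussBall ψ μ (r * a) n := by
  rw [gaussBall_def, gaussBall_def, psiSq_mulShift]

/-- `g_{rη}(a x²) = g_η((r a) x²)`. [cite: Rangarao1993, Appendix A.3, p. 367] -/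
theorem weilGauss_mulShift (r a : F) : weilGauss (ψ.mulShift r) μ a = weilGauss ψ μ (r * a) := by
  unfold weilGauss
  congr 1
  funext n
  exact gaussBall_mulShift μ ψ r a n

/-- **`γ_{rη}(a x²) = γ_η((r a) x²)`** — the Weil index for the dilated character `rη : x ↦ η(rx)`.
[cite: Rangarao1993, Appendix A.3, p. 367] -/
theorem weilIndex_mulShift (r a : F) : weilIndex (ψ.mulShift r) μ a = weilIndex ψ μ (r * a) := by
  rw [weilIndex_def, weilIndex_def, weilGauss_mulShift]

end Dilation

variable (K : Type) [Field K] [NumberField K] (v : HeightOneSpectrum (𝓞 K))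

/-! ## §2 (first, no measure needed) `(a, Π bⱼ)_v = Π (a, bⱼ)_v` -/

/-- **the Hilbert symbol of a product**: `(a, Π_{j ∈ s} bⱼ)_v = Π_{j ∈ s} (a, bⱼ)_v` for `a, bⱼ ∈ K_vˣ` (bimultiplicativity,
O'Meara 63:13a at every finite place). [cite: Rangarao1993, Appendix Thm A.4, p. 367] -/
theorem hilbertSymbol_adicCompletion_prod_right {ι : Type*} (s : Finset ι) {a : v.adicCompletion K} (ha : a ≠ 0)
    {b : ι → v.adicCompletion K} (hb : ∀ j ∈ s, b j ≠ 0) :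
    QuadraticForms.hilbertSymbol (v.adicCompletion K) a (∏ j ∈ s, b j) =
      ∏ j ∈ s, QuadraticForms.hilbertSymbol (v.adicCompletion K) a (b j) := by
  classical
  induction s using Finset.induction_on with
  | empty => simp [QuadraticForms.hilbertSymbol_one_right]
  | insert i s hi ih =>
    rw [Finset.prod_insert hi, Finset.prod_insert hi,
      QuadraticForms.hilbertSymbol_adicCompletion_mul_right K v (hb i (Finset.mem_insert_self i s))
        (Finset.prod_ne_zero_iff.2 fun j hj => hb j (Finset.mem_insert_of_mem hj)) ha,
      ih fun j hj => hb j (Finset.mem_insert_of_mem hj)]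

/-- `(a, b)_v (-a, b)_v = (-1, b)_v` (helper: bimultiplicativity and `(a², b)_v = 1`).
[cite: Rangarao1993, Appendix Thm A.4, p. 367] -/
private theorem hilbertSymbol_mul_hilbertSymbol_neg (a b : v.adicCompletion K) (ha : a ≠ 0) (hb : b ≠ 0) :
    QuadraticForms.hilbertSymbol (v.adicCompletion K) a b * QuadraticForms.hilbertSymbol (v.adicCompletion K) (-a) b =
      QuadraticForms.hilbertSymbol (v.adicCompletion K) (-1) b := by
  rw [← QuadraticForms.hilbertSymbol_adicCompletion_mul_left K v ha (neg_ne_zero.2 ha) hb,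
    show a * -a = -1 * (a * a) by ring,
    QuadraticForms.hilbertSymbol_adicCompletion_mul_left K v (neg_ne_zero.2 one_ne_zero) (mul_ne_zero ha ha) hb,
    QuadraticForms.hilbertSymbol_eq_one_of_isSquare ⟨a, rfl⟩ (mul_ne_zero ha ha), mul_one]

/-- `(a, b)_v² = 1` in `ℂ` (helper). [folklore] -/
private theorem hilbertSymbol_sq_eq_one' (a b : v.adicCompletion K) :
    ((QuadraticForms.hilbertSymbol (v.adicCompletion K) a b : ℂ)) ^ 2 = 1 := by
  rcases QuadraticForms.hilbertSymbol_eq_one_or_eq_neg_one a b with h | h <;> simp [h]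

variable [MeasurableSpace (v.adicCompletion K)] [BorelSpace (v.adicCompletion K)]
  (μ : Measure (v.adicCompletion K)) [μ.IsAddHaarMeasure] {ψ : AddChar (v.adicCompletion K) Circle}

/-! ## §1 Rao's Theorem A.4: `γ(a) γ(b) = (a,b)_v γ(1) γ(ab)` -/

/-- `γ(b) ≠ 0` (helper: `|γ(b)| = 1`). [cite: Weil1964, Chap. II n° 24, p. 173] -/
private theorem weilIndex_ne_zero' (hψ : ψ.IsContinuousNontrivial) {b : v.adicCompletion K} (hb : b ≠ 0) :
    weilIndex ψ μ b ≠ 0 := by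
  haveI : CharZero (v.adicCompletion K) := charZero_of_injective_algebraMap (algebraMap K _).injective
  exact norm_ne_zero_iff.1 (by rw [norm_weilIndex μ hψ hb two_ne_zero]; exact one_ne_zero)

/-- **RAO'S THEOREM A.4 (after Weil p. 176), symmetric form**: for `a b ∈ K_vˣ`,
`γ(a) γ(b) = (a, b)_v · γ(1) γ(ab)` — equivalently `γ_F(ab) γ_F(a)⁻¹ γ_F(b)⁻¹ = (a,b)_F` for Rao's `γ_F(a, ψ) = γ(a)/γ(1)`.
Derived from Weil's (28) `γ(b) γ(-ab) = (a,b) γ(1) γ(-a)` (at `(-a, b)` and `(-1, b)`) and bimultiplicativity.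
[cite: Rangarao1993, Appendix Thm A.4, p. 367] -/
theorem weilIndex_mul_weilIndex_eq_hilbertSymbol_mul_one_mul (hψ : ψ.IsContinuousNontrivial) {a b : v.adicCompletion K}
    (ha : a ≠ 0) (hb : b ≠ 0) :
    weilIndex ψ μ a * weilIndex ψ μ b =
      (QuadraticForms.hilbertSymbol (v.adicCompletion K) a b : ℂ) * (weilIndex ψ μ 1 * weilIndex ψ μ (a * b)) := by
  -- Weil's law at `(-a, b)`: `γ(b) γ(ab) = (-a, b) γ(1) γ(a)`
  have L2 := weilIndex_hilbertSymbol_law_adicCompletion K v μ hψ (neg_ne_zero.2 ha) hb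
  rw [show -(-a * b) = a * b by ring, neg_neg] at L2
  -- Weil's law at `(-1, b)`: `γ(b) γ(b) = (-1, b) γ(1) γ(1)`
  have L1 := weilIndex_hilbertSymbol_law_adicCompletion K v μ hψ (neg_ne_zero.2 one_ne_zero) hb
  rw [show -(-1 * b) = b by ring, neg_neg] at L1
  have hsym := hilbertSymbol_mul_hilbertSymbol_neg K v a b ha hb
  apply mul_right_cancel₀ (weilIndex_ne_zero' K v μ hψ hb)
  calc weilIndex ψ μ a * weilIndex ψ μ b * weilIndex ψ μ b
      = weilIndex ψ μ a * (weilIndex ψ μ b * weilIndex ψ μ b) := by ring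
    _ = weilIndex ψ μ a * ((QuadraticForms.hilbertSymbol (v.adicCompletion K) (-1) b : ℂ) *
          (weilIndex ψ μ 1 * weilIndex ψ μ 1)) := by rw [L1]
    _ = ((QuadraticForms.hilbertSymbol (v.adicCompletion K) a b : ℂ) *
          (QuadraticForms.hilbertSymbol (v.adicCompletion K) (-a) b : ℂ)) *
          (weilIndex ψ μ 1 * weilIndex ψ μ 1) * weilIndex ψ μ a := by rw [← Int.cast_mul, hsym]; ring
    _ = (QuadraticForms.hilbertSymbol (v.adicCompletion K) a b : ℂ) * weilIndex ψ μ 1 *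
          ((QuadraticForms.hilbertSymbol (v.adicCompletion K) (-a) b : ℂ) * (weilIndex ψ μ 1 * weilIndex ψ μ a)) := by
        ring
    _ = (QuadraticForms.hilbertSymbol (v.adicCompletion K) a b : ℂ) * weilIndex ψ μ 1 *
          (weilIndex ψ μ b * weilIndex ψ μ (a * b)) := by rw [← L2]
    _ = (QuadraticForms.hilbertSymbol (v.adicCompletion K) a b : ℂ) * (weilIndex ψ μ 1 * weilIndex ψ μ (a * b)) *
          weilIndex ψ μ b := by ring

/-- **Rao's Theorem A.4, multiplicative form**: `γ(1) γ(ab) = (a, b)_v γ(a) γ(b)`, i.e. `γ_F(ab) = (a,b)_F γ_F(a) γ_F(b)`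
("the function `a ↦ γ_F(a, η)` is a character of second degree on `Fˣ/Fˣ²`").
[cite: Rangarao1993, Appendix Thm A.4, p. 367] -/
theorem weilIndex_one_mul_weilIndex_mul (hψ : ψ.IsContinuousNontrivial) {a b : v.adicCompletion K}
    (ha : a ≠ 0) (hb : b ≠ 0) :
    weilIndex ψ μ 1 * weilIndex ψ μ (a * b) =
      (QuadraticForms.hilbertSymbol (v.adicCompletion K) a b : ℂ) * (weilIndex ψ μ a * weilIndex ψ μ b) := by
  rw [weilIndex_mul_weilIndex_eq_hilbertSymbol_mul_one_mul K v μ hψ ha hb, ← mul_assoc, ← pow_two, hilbertSymbol_sq_eq_one',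
    one_mul]

/-- **Rao's Corollary A.5 (1)**: `γ_F(a, cψ) = (a, c)_F γ_F(a, ψ)` — the dependence of the normalised Weil index on
the additive character: `γ_{cψ}(a) γ_ψ(1) = (a,c)_v γ_ψ(a) γ_{cψ}(1)`. [cite: Rangarao1993, Appendix Cor. A.5, p. 367] -/
theorem weilIndex_mulShift_mul_weilIndex_one (hψ : ψ.IsContinuousNontrivial) {a c : v.adicCompletion K}
    (ha : a ≠ 0) (hc : c ≠ 0) :
    weilIndex (ψ.mulShift c) μ a * weilIndex ψ μ 1 =
      (QuadraticForms.hilbertSymbol (v.adicCompletion K) a c : ℂ) * (weilIndex ψ μ a * weilIndex (ψ.mulShift c) μ 1) := by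
  rw [weilIndex_mulShift, weilIndex_mulShift, mul_one, mul_comm c a, mul_comm (weilIndex ψ μ (a * c)),
    weilIndex_one_mul_weilIndex_mul K v μ hψ ha hc]

/-! ## §3 Rao's Lemma A.7 (3): the diagonal form `Σ cᵢ xᵢ²` -/

/-- **RAO'S LEMMA A.7 (3)**: for `c : Fin n → K_vˣ`,
`(Πᵢ γ(cᵢ)) · γ(1) = γ(1)ⁿ · γ(Πᵢ cᵢ) · Π_{i<j} (cᵢ, cⱼ)_v` — the Weil index of the diagonal form `Σ cᵢ xᵢ²` is
`γ_F(ψ)ⁿ γ_F(det, ψ) h_F` with Hasse invariant `h_F = Π_{i<j}(cᵢ,cⱼ)` ("proved by induction on `m` using Theorem A.2").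
[cite: Rangarao1993, Appendix Lemma A.7, pp. 367–368] -/
theorem prod_weilIndex_mul_weilIndex_one (hψ : ψ.IsContinuousNontrivial) :
    ∀ {n : ℕ} {c : Fin n → v.adicCompletion K}, (∀ i, c i ≠ 0) →
      (∏ i, weilIndex ψ μ (c i)) * weilIndex ψ μ 1 =
        weilIndex ψ μ 1 ^ n * weilIndex ψ μ (∏ i, c i) *
          (QuadraticForms.hasseProd (QuadraticForms.hilbertSymbol (v.adicCompletion K)) c : ℂ) := by
  intro n
  induction n with
  | zero => intro c _; simp
  | succ n ih =>
    intro c hc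
    have hc' : ∀ j : Fin n, c (Fin.succ j) ≠ 0 := fun j => hc _
    have hP : (∏ j : Fin n, c (Fin.succ j)) ≠ 0 := Finset.prod_ne_zero_iff.2 fun j _ => hc' j
    have IH := ih hc'
    rw [Fin.prod_univ_succ, Fin.prod_univ_succ,
      QuadraticForms.hasseProd_eq_succAbove QuadraticForms.hilbertSymbol_comm c 0]
    simp only [Fin.succAbove_zero]
    rw [← hilbertSymbol_adicCompletion_prod_right K v Finset.univ (hc 0) (fun j _ => hc' j), Int.cast_mul]
    calc weilIndex ψ μ (c 0) * (∏ j : Fin n, weilIndex ψ μ (c (Fin.succ j))) * weilIndex ψ μ 1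
        = weilIndex ψ μ (c 0) * ((∏ j : Fin n, weilIndex ψ μ (c (Fin.succ j))) * weilIndex ψ μ 1) := by ring
      _ = weilIndex ψ μ (c 0) * (weilIndex ψ μ 1 ^ n * weilIndex ψ μ (∏ j : Fin n, c (Fin.succ j)) *
            (QuadraticForms.hasseProd (QuadraticForms.hilbertSymbol (v.adicCompletion K))
              (fun j : Fin n => c (Fin.succ j)) : ℂ)) := by rw [IH]
      _ = weilIndex ψ μ 1 ^ n * (weilIndex ψ μ (c 0) * weilIndex ψ μ (∏ j : Fin n, c (Fin.succ j))) *
            (QuadraticForms.hasseProd (QuadraticForms.hilbertSymbol (v.adicCompletion K))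
              (fun j : Fin n => c (Fin.succ j)) : ℂ) := by ring
      _ = weilIndex ψ μ 1 ^ n * ((QuadraticForms.hilbertSymbol (v.adicCompletion K) (c 0) (∏ j : Fin n, c (Fin.succ j)) : ℂ) *
            (weilIndex ψ μ 1 * weilIndex ψ μ (c 0 * ∏ j : Fin n, c (Fin.succ j)))) *
            (QuadraticForms.hasseProd (QuadraticForms.hilbertSymbol (v.adicCompletion K))
              (fun j : Fin n => c (Fin.succ j)) : ℂ) := by
          rw [weilIndex_mul_weilIndex_eq_hilbertSymbol_mul_one_mul K v μ hψ (hc 0) hP]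
      _ = weilIndex ψ μ 1 ^ (n + 1) * weilIndex ψ μ (c 0 * ∏ j : Fin n, c (Fin.succ j)) *
            ((QuadraticForms.hilbertSymbol (v.adicCompletion K) (c 0) (∏ j : Fin n, c (Fin.succ j)) : ℂ) *
              (QuadraticForms.hasseProd (QuadraticForms.hilbertSymbol (v.adicCompletion K))
                (fun j : Fin n => c (Fin.succ j)) : ℂ)) := by ring

/-! ## §4 The Weil index of a non-degenerate quadratic form on `K_vⁿ` -/

/-- **`γ(f) · γ(1) = γ(1)ⁿ · γ(disc f) · ε(f)`** for a non-degenerate quadratic form `f` on `K_vⁿ` and ANY diagonalisation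
`f = (Σ cᵢ xᵢ²) ∘ A` (`A ∈ GLₙ(K_v)`, `cᵢ ≠ 0`): `disc = Π cᵢ`, `ε = Π_{i<j} (cᵢ, cⱼ)_v`. In Rao's notation
`γ(ψ ∘ Q) = γ_F(ψ)ⁿ γ_F(det Q, ψ) h_F(Q)` with `h_F(Q) = Π_{i<j}(cᵢ,cⱼ)` (Def. A.6 + Lemma A.7(3)).
[cite: Rangarao1993, Appendix Def. A.6 and Lemma A.7, pp. 367–368] -/
theorem weilIndexQF_mul_weilIndex_one (hψ : ψ.IsContinuousNontrivial) {n : ℕ}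
    {Q : QuadraticForm (v.adicCompletion K) (Fin n → v.adicCompletion K)} {c : Fin n → v.adicCompletion K}
    {A : (Fin n → v.adicCompletion K) ≃ₗ[v.adicCompletion K] (Fin n → v.adicCompletion K)} (hc : ∀ i, c i ≠ 0)
    (hQ : ∀ x, Q x = weightedSumSquares (v.adicCompletion K) c (A x)) :
    weilIndexQF ψ μ Q * weilIndex ψ μ 1 =
      weilIndex ψ μ 1 ^ n * weilIndex ψ μ (∏ i, c i) *
        (QuadraticForms.hasseProd (QuadraticForms.hilbertSymbol (v.adicCompletion K)) c : ℂ) := by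
  haveI : CharZero (v.adicCompletion K) := charZero_of_injective_algebraMap (algebraMap K _).injective
  haveI : Invertible (2 : v.adicCompletion K) := invertibleOfNonzero two_ne_zero
  rw [weilIndexQF_eq_prod_weilIndex μ hψ hc hQ]
  exact prod_weilIndex_mul_weilIndex_one K v μ hψ hc

/-- **the diagonal case**: `γ(Σ cᵢ xᵢ²) · γ(1) = γ(1)ⁿ · γ(Π cᵢ) · Π_{i<j} (cᵢ, cⱼ)_v`.
[cite: Rangarao1993, Appendix Lemma A.7, pp. 367–368] -/
theorem weilIndexQF_weightedSumSquares_mul_weilIndex_one (hψ : ψ.IsContinuousNontrivial) {n : ℕ}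
    {c : Fin n → v.adicCompletion K} (hc : ∀ i, c i ≠ 0) :
    weilIndexQF ψ μ (weightedSumSquares (v.adicCompletion K) c) * weilIndex ψ μ 1 =
      weilIndex ψ μ 1 ^ n * weilIndex ψ μ (∏ i, c i) *
        (QuadraticForms.hasseProd (QuadraticForms.hilbertSymbol (v.adicCompletion K)) c : ℂ) :=
  weilIndexQF_mul_weilIndex_one K v μ hψ (A := LinearEquiv.refl _ _) hc fun _ => rfl

end Literature.NumberTheory.Weil1964
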